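import Literature.MathematicalPhysics.QuantumFieldTheory.Balaban1983to89.HaarAnalyticZeroSetNullLocalPi
import Literature.MathematicalPhysics.QuantumFieldTheory.Balaban1983to89.UnitaryModel

/-!
# `Balaban1983to89.HaarAnalyticZeroSetNullLocalCutoff` — SHARP CUT-OFFS BY REAL-ANALYTIC THRESHOLDS ARE ALMOST-EVERYWHERE
# CONTINUOUS, WITH NO CONNECTEDNESS AND NO NON-DEGENERACY HYPOTHESIS: for a compact group `G` faithfully represented on
# a log-charted linear group, EVERY Haar measure `μ` (one variable or finitely many), `W` open, `f` REAL-analytic on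
# `W` only, and any level `r`, for `μ`-a.e. (`(⊗_ι μ)`-a.e.) point `g` of `G ∩ W` the strict sub-level set
# `{f ∘ ρ < r}` and the level set `{f ∘ ρ = r}` are LOCALLY CONSTANT at `g`; hence `𝟙[f ∘ ρ < r]`, `𝟙[f ∘ ρ ≤ r]` are
# continuous at a.e. configuration — in particular for the gauge-field measure `dU = Π_b dU(b)` on `SU(N)`-configurations

statement-level skeleton of published theorems with citation tags; proofs where landed; nothing here is a claim
about the Yang–Mills mass gap

Cell `pub-ymgap` (YM-PLAN Track A), node N09 [B12] width seat `pub-ymgap-dag-n09-w3` (g4), `--supports` K1⁷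
`StabilityBAtRecordR13SepCoPH` = stmt-QuantumFields-20542 as a count-neutral helper.  File 5 (the consumer face) of this
seat's OPEN-SET (local) edition of the real-analytic zero-set nullity (files 1–4: `HaarAnalyticZeroSetNullLocal`,
`…LocalPiEngine`, `…LocalPi`, `…LocalGroups`).  THE POINT.  A sharp cut-off `𝟙[f < r]` is continuous at `g` unless `g`
lies on the level set `{f = r}`; by the flat-locus theorem (file 1 §2 ∕ file 3 §1) almost every point of the level set
is a FLAT point, where `f ≡ r` on a whole neighbourhood — and there the cut-off is locally constant TOO.  So the
exceptional set of the dominated-convergence ∕ continuity arguments is null WITHOUT deciding whether the level set itself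
is null (no connectedness of the small-field domain, no witness `f(g₀) ≠ r`, no surjectivity of the exponential chart).
LOCATED CONSUMER (pub-ymgap NODE 00 ∕ N09; node00-def-K0e `P7-LOCATOR-AUDIT.md` §4 (F2) «the SHARP characteristic functions
integrated over fibres … must be null ∕ a.e. continuous»; dag-n09-w3 g3 `HANDOFF.md` §g3.3): the (2.17) small-field functions
of [Balaban1987RG1] threshold real-analytic functionals of the LOCAL minimiser, analytic only on the small-field domain;
with this file their `dU`-a.e. continuity needs only that analyticity (N07's ∕ (F1)'s content, NOT claimed here).

CITATION HEADER.  [BrockerTomDieck1985] Th. Bröcker, T. tom Dieck, *Representations of Compact Lie Groups*, GTM 98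
(1985), Ch. IV Thm. (2.11) (proof principle «every chart of the manifold G maps the set … to a set of measure zero in
ℝⁿ»), Ch. I (5.12).  [Mityagin2015] B. S. Mityagin, Math. Notes **107** (2020) ∕ arXiv:1512.07276, Prop. 1 (PROVED in the
tree; through files 1–3).  [Balaban1985Averaging] T. Bałaban, CMP **98** (1985) 17–51, (10) p. 19 (`dU` = the tree's
`Setup.fieldMeasure`).  [Balaban1987RG1] T. Bałaban, CMP **109** (1987) 249–301, (2.17) p. 266 (the sharp small-field
functions — the located consumer; nothing of the paper is asserted).

WHAT IS PROVED (theorems only; 0 definitions, 0 named facts, 0 sorry; axioms standard).  SETTING of files 1–3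
(`h : IsChartRep C ρ`, `hlie`, `G` compact, `μ` ANY Haar measure), `W` open, `f` REAL-valued with `AnalyticOnNhd ℝ f W`,
`r : ℝ`.
* §1 ONE VARIABLE — `analyticOnNhd_ofReal_sub` (`x ↦ ((f x − r : ℝ) : ℂ)` is real-analytic on `W`),
  ★★★ `ae_eventually_lt_iff_and_eq_iff` (for `μ`-a.e. `g` with `ρ g ∈ W`:
  `∀ᶠ g' in 𝓝 g, (f(ρ g') < r ↔ f(ρ g) < r) ∧ (f(ρ g') = r ↔ f(ρ g) = r)`), ★★ `ae_continuousAt_ite_lt` ∕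
  ★★ `ae_continuousAt_ite_le` (the sharp cut-offs `𝟙[f∘ρ < r]`, `𝟙[f∘ρ ≤ r]` are continuous at `μ`-a.e. point of `G ∩ W`).
* §2 FINITELY MANY VARIABLES — ★★★ `ae_pi_eventually_lt_iff_and_eq_iff`, ★★ `ae_pi_continuousAt_ite_lt`,
  ★★ `ae_pi_continuousAt_ite_le` (the same for `(⊗_ι μ)` on `G^ι`, `W ⊆ 𝔸^ι` open), ★★ `ae_pi_eventually_forall_lt_iff`
  (a finite conjunction `{∀ p, f_p ∘ ρ^ι < r_p}` is a.e. locally constant — the (2.17) cube-condition shape).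
* §3 INSTANCES — `SU(N)^ι` (`pi_specialUnitaryGroup_ae_continuousAt_ite_lt`) and the gauge-field measure:
  ★★★ `fieldMeasure_ae_eventually_lt_iff_and_eq_iff`, ★★ `fieldMeasure_ae_continuousAt_ite_lt`,
  ★★ `fieldMeasure_ae_continuousAt_ite_le` (`dU`-a.e. configuration `U ∈ W` is a continuity point of `𝟙[f < r]`, `𝟙[f ≤ r]`),
  ★★ `fieldMeasure_ae_eventually_forall_lt_iff` (finite conjunctions).

HONEST SCOPE.  (i) `f` real-valued; a complex ∕ vector threshold is handled through `‖·‖²` or componentwise by the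
consumer.  (ii) Whether the level set `{f = r}` itself is null is NOT decided here (that needs file 1 ∕ 3's preconnected
forms and a witness); for a.e. CONTINUITY it is not needed.  (iii) Nothing of files 1–4 or of Mathlib is re-proved.
(iv) No claim about Bałaban's renormalization group: no threshold functional of the record is constructed; `hreg`∕`contTOn`
stay displayed; N09 is NOT discharged; nothing continuum ∕ OS ∕ mass gap ∕ Clay.
-/

noncomputable section

open NormedSpace Set Function Filter Topology MeasureTheory
open scoped ENNReal NNReal

namespace Literature.MathematicalPhysics.QuantumFieldTheory.Balaban1983to89.HaarAnalyticZeroSetNullLocalCutoff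

open HaarExponentialChart HaarExponentialChart.IsChartRep
open HaarAnalyticZeroSetNullLocal HaarAnalyticZeroSetNullLocalPiEngine HaarAnalyticZeroSetNullLocalPi

section Generic

variable {𝔸 : Type*} [NormedRing 𝔸] [NormedAlgebra ℂ 𝔸] [CompleteSpace 𝔸]
variable {G : Type*} [Group G] [TopologicalSpace G] [IsTopologicalGroup G] [CompactSpace G]
variable {C : LogChart 𝔸} {ρ : G →* 𝔸} [FiniteDimensional ℝ C.lie]
variable [MeasurableSpace G] [BorelSpace G] (μ : Measure G) [μ.IsHaarMeasure]

/-! ## §1 One group variable -/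

omit [CompleteSpace 𝔸] in
/-- For `f` real-valued and real-analytic on `W`, `x ↦ ((f x − r : ℝ) : ℂ)` is real-analytic on `W` (so the `ℂ`-valued
zero-set theorems of files 1–3 apply to the level set `{f = r}`). [cite: Mityagin2015, Proposition 1] -/
theorem analyticOnNhd_ofReal_sub {E : Type*} [NormedAddCommGroup E] [NormedSpace ℝ E] {W : Set E} {f : E → ℝ}
    (hf : AnalyticOnNhd ℝ f W) (r : ℝ) : AnalyticOnNhd ℝ (fun x => ((f x - r : ℝ) : ℂ)) W := fun x hx =>
  (Complex.ofRealCLM.analyticAt _).comp ((hf x hx).sub analyticAt_const)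

/-- Pointwise core of the cut-off theorems: if `F` is continuous at `g`, and either `F g ≠ r` or `F ≡ r` near `g`, then the
strict sub-level set and the level set of `F` at level `r` are locally constant at `g`. [folklore] -/
private theorem eventually_lt_iff_and_eq_iff_of_dichotomy {X : Type*} [TopologicalSpace X] {F : X → ℝ} {r : ℝ} {g : X}
    (hc : ContinuousAt F g) (hd : F g = r → ∀ᶠ g' in 𝓝 g, F g' = r) :
    ∀ᶠ g' in 𝓝 g, (F g' < r ↔ F g < r) ∧ (F g' = r ↔ F g = r) := by
  rcases lt_trichotomy (F g) r with hlt | heq | hgt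
  · filter_upwards [hc.eventually (gt_mem_nhds hlt)] with g' hg'
    exact ⟨⟨fun _ => hlt, fun _ => hg'⟩, ⟨fun h' => absurd h' (ne_of_lt hg'), fun h' => absurd h' (ne_of_lt hlt)⟩⟩
  · filter_upwards [hd heq] with g' hg'
    refine ⟨⟨fun h' => absurd hg' (ne_of_lt h'), fun h' => absurd heq (ne_of_lt h')⟩, ⟨fun _ => heq, fun _ => hg'⟩⟩
  · filter_upwards [hc.eventually (lt_mem_nhds hgt)] with g' hg'
    exact ⟨⟨fun h' => absurd (lt_trans hg' h') (lt_irrefl _), fun h' => absurd (lt_trans hgt h') (lt_irrefl _)⟩,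
      ⟨fun h' => absurd h' (ne_of_gt hg'), fun h' => absurd h' (ne_of_gt hgt)⟩⟩

/-- From local constancy of `{F < r}` ∕ `{F = r}` at `g`: the sharp cut-offs `𝟙[F < r]` and `𝟙[F ≤ r]` are continuous at
`g`. [folklore] -/
private theorem continuousAt_ite_of_eventually {X : Type*} [TopologicalSpace X] {F : X → ℝ} {r : ℝ} {g : X}
    (hev : ∀ᶠ g' in 𝓝 g, (F g' < r ↔ F g < r) ∧ (F g' = r ↔ F g = r)) :
    ContinuousAt (fun g' => if F g' < r then (1 : ℝ) else 0) g ∧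
      ContinuousAt (fun g' => if F g' ≤ r then (1 : ℝ) else 0) g := by
  constructor
  · refine (continuousAt_const (y := if F g < r then (1 : ℝ) else 0)).congr_of_eventuallyEq ?_
    filter_upwards [hev] with g' hg'
    simp only [hg'.1]
  · refine (continuousAt_const (y := if F g ≤ r then (1 : ℝ) else 0)).congr_of_eventuallyEq ?_
    filter_upwards [hev] with g' hg'
    have : (F g' ≤ r ↔ F g ≤ r) := by
      rw [le_iff_lt_or_eq, le_iff_lt_or_eq, hg'.1, hg'.2]
    simp only [this]

/-- ★★★ **THE SUB-LEVEL AND LEVEL SETS OF A REAL-ANALYTIC THRESHOLD ARE A.E. LOCALLY CONSTANT**: for `W ⊆ 𝔸` open,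
`f : 𝔸 → ℝ` real-analytic on `W`, `r : ℝ` and every Haar measure `μ`: for `μ`-a.e. `g` with `ρ g ∈ W`,
`∀ᶠ g' in 𝓝 g, (f(ρ g') < r ↔ f(ρ g) < r) ∧ (f(ρ g') = r ↔ f(ρ g) = r)` — off the level set by continuity, on it because
a.e. point of the level set is flat (file 1 `ae_eventually_eq_zero_of_eq_zero`).  NO connectedness, NO witness, NO
surjectivity of `Θ`. [cite: BrockerTomDieck1985, IV (2.11) (proof)] [cite: Mityagin2015, Proposition 1] -/
theorem ae_eventually_lt_iff_and_eq_iff (h : IsChartRep C ρ)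
    (hlie : ∀ x ∈ C.lie, ∀ y ∈ C.lie, x * y - y * x ∈ C.lie) {W : Set 𝔸} (hW : IsOpen W) {f : 𝔸 → ℝ}
    (hf : AnalyticOnNhd ℝ f W) (r : ℝ) :
    ∀ᵐ g ∂μ, ρ g ∈ W → ∀ᶠ g' in 𝓝 g, (f (ρ g') < r ↔ f (ρ g) < r) ∧ (f (ρ g') = r ↔ f (ρ g) = r) := by
  filter_upwards [ae_eventually_eq_zero_of_eq_zero μ h hlie hW (analyticOnNhd_ofReal_sub hf r)] with g hg hgW
  refine eventually_lt_iff_and_eq_iff_of_dichotomy ?_ (fun heq => ?_)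
  · exact (hf.continuousOn.continuousAt (hW.mem_nhds hgW)).comp h.continuous.continuousAt
  · have h0 : ((f (ρ g) - r : ℝ) : ℂ) = 0 := by rw [heq, sub_self, Complex.ofReal_zero]
    filter_upwards [hg hgW h0] with g' hg'
    have : (f (ρ g') - r : ℝ) = 0 := by exact_mod_cast hg'
    linarith

/-- ★★ **SHARP CUT-OFFS BY A REAL-ANALYTIC THRESHOLD ARE A.E. CONTINUOUS** (one variable): for `μ`-a.e. `g` with `ρ g ∈ W`,
`g' ↦ 𝟙[f(ρ g') < r]` is continuous at `g`. [cite: BrockerTomDieck1985, IV (2.11) (proof)] [cite: Mityagin2015, Proposition 1] -/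
theorem ae_continuousAt_ite_lt (h : IsChartRep C ρ)
    (hlie : ∀ x ∈ C.lie, ∀ y ∈ C.lie, x * y - y * x ∈ C.lie) {W : Set 𝔸} (hW : IsOpen W) {f : 𝔸 → ℝ}
    (hf : AnalyticOnNhd ℝ f W) (r : ℝ) :
    ∀ᵐ g ∂μ, ρ g ∈ W → ContinuousAt (fun g' : G => if f (ρ g') < r then (1 : ℝ) else 0) g := by
  filter_upwards [ae_eventually_lt_iff_and_eq_iff μ h hlie hW hf r] with g hg hgW
  exact (continuousAt_ite_of_eventually (hg hgW)).1

/-- ★★ The same for the closed cut-off `𝟙[f(ρ g') ≤ r]`. [cite: BrockerTomDieck1985, IV (2.11) (proof)]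
[cite: Mityagin2015, Proposition 1] -/
theorem ae_continuousAt_ite_le (h : IsChartRep C ρ)
    (hlie : ∀ x ∈ C.lie, ∀ y ∈ C.lie, x * y - y * x ∈ C.lie) {W : Set 𝔸} (hW : IsOpen W) {f : 𝔸 → ℝ}
    (hf : AnalyticOnNhd ℝ f W) (r : ℝ) :
    ∀ᵐ g ∂μ, ρ g ∈ W → ContinuousAt (fun g' : G => if f (ρ g') ≤ r then (1 : ℝ) else 0) g := by
  filter_upwards [ae_eventually_lt_iff_and_eq_iff μ h hlie hW hf r] with g hg hgW
  exact (continuousAt_ite_of_eventually (hg hgW)).2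

/-! ## §2 Finitely many group variables -/

/-- ★★★ **FINITELY MANY VARIABLES**: for `W ⊆ 𝔸^ι` open, `f : 𝔸^ι → ℝ` real-analytic on `W`, `r : ℝ`: for `(⊗_ι μ)`-a.e.
`g` with `ρ∘g ∈ W`, `∀ᶠ g' in 𝓝 g, (f(ρ∘g') < r ↔ f(ρ∘g) < r) ∧ (f(ρ∘g') = r ↔ f(ρ∘g) = r)` (file 3's
`ae_pi_eventually_eq_zero_of_eq_zero`). [cite: BrockerTomDieck1985, IV (2.11) (proof), I (5.12)]
[cite: Mityagin2015, Proposition 1] -/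
theorem ae_pi_eventually_lt_iff_and_eq_iff (h : IsChartRep C ρ)
    (hlie : ∀ x ∈ C.lie, ∀ y ∈ C.lie, x * y - y * x ∈ C.lie) {ι : Type*} [Fintype ι] {W : Set (ι → 𝔸)}
    (hW : IsOpen W) {f : (ι → 𝔸) → ℝ} (hf : AnalyticOnNhd ℝ f W) (r : ℝ) :
    ∀ᵐ g ∂(Measure.pi fun _ : ι => μ), (fun i => ρ (g i)) ∈ W →
      ∀ᶠ g' in 𝓝 g, (f (fun i => ρ (g' i)) < r ↔ f (fun i => ρ (g i)) < r) ∧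
        (f (fun i => ρ (g' i)) = r ↔ f (fun i => ρ (g i)) = r) := by
  filter_upwards [ae_pi_eventually_eq_zero_of_eq_zero μ h hlie hW (analyticOnNhd_ofReal_sub hf r)] with g hg hgW
  refine eventually_lt_iff_and_eq_iff_of_dichotomy ?_ (fun heq => ?_)
  · exact (hf.continuousOn.continuousAt (hW.mem_nhds hgW)).comp (continuous_rho_pi h).continuousAt
  · have h0 : ((f (fun i => ρ (g i)) - r : ℝ) : ℂ) = 0 := by rw [heq, sub_self, Complex.ofReal_zero]
    filter_upwards [hg hgW h0] with g' hg'
    have : (f (fun i => ρ (g' i)) - r : ℝ) = 0 := by exact_mod_cast hg'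
    linarith

/-- ★★ **SHARP CUT-OFFS ARE A.E. CONTINUOUS** (finitely many variables): `(⊗_ι μ)`-a.e. `g` with `ρ∘g ∈ W` is a
continuity point of `g' ↦ 𝟙[f(ρ∘g') < r]`. [cite: BrockerTomDieck1985, IV (2.11) (proof), I (5.12)]
[cite: Mityagin2015, Proposition 1] -/
theorem ae_pi_continuousAt_ite_lt (h : IsChartRep C ρ)
    (hlie : ∀ x ∈ C.lie, ∀ y ∈ C.lie, x * y - y * x ∈ C.lie) {ι : Type*} [Fintype ι] {W : Set (ι → 𝔸)}
    (hW : IsOpen W) {f : (ι → 𝔸) → ℝ} (hf : AnalyticOnNhd ℝ f W) (r : ℝ) :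
    ∀ᵐ g ∂(Measure.pi fun _ : ι => μ), (fun i => ρ (g i)) ∈ W →
      ContinuousAt (fun g' : ι → G => if f (fun i => ρ (g' i)) < r then (1 : ℝ) else 0) g := by
  filter_upwards [ae_pi_eventually_lt_iff_and_eq_iff μ h hlie hW hf r] with g hg hgW
  exact (continuousAt_ite_of_eventually (hg hgW)).1

/-- ★★ The same for the closed cut-off `𝟙[f(ρ∘g') ≤ r]`. [cite: BrockerTomDieck1985, IV (2.11) (proof), I (5.12)]
[cite: Mityagin2015, Proposition 1] -/
theorem ae_pi_continuousAt_ite_le (h : IsChartRep C ρ)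
    (hlie : ∀ x ∈ C.lie, ∀ y ∈ C.lie, x * y - y * x ∈ C.lie) {ι : Type*} [Fintype ι] {W : Set (ι → 𝔸)}
    (hW : IsOpen W) {f : (ι → 𝔸) → ℝ} (hf : AnalyticOnNhd ℝ f W) (r : ℝ) :
    ∀ᵐ g ∂(Measure.pi fun _ : ι => μ), (fun i => ρ (g i)) ∈ W →
      ContinuousAt (fun g' : ι → G => if f (fun i => ρ (g' i)) ≤ r then (1 : ℝ) else 0) g := by
  filter_upwards [ae_pi_eventually_lt_iff_and_eq_iff μ h hlie hW hf r] with g hg hgW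
  exact (continuousAt_ite_of_eventually (hg hgW)).2


/-- ★★ **FINITELY MANY THRESHOLDS AT ONCE**: for a finite family `f_p` of real-analytic functions on `W` and levels `r_p`,
`(⊗_ι μ)`-a.e. `g` with `ρ∘g ∈ W` is a point of local constancy of the joint small-field condition `{∀ p, f_p ∘ ρ^ι < r_p}`
(the shape of the (2.17) cube conditions `sup_p |…| < ε`). [cite: BrockerTomDieck1985, IV (2.11) (proof), I (5.12)]
[cite: Mityagin2015, Proposition 1] -/
theorem ae_pi_eventually_forall_lt_iff (h : IsChartRep C ρ)
    (hlie : ∀ x ∈ C.lie, ∀ y ∈ C.lie, x * y - y * x ∈ C.lie) {ι : Type*} [Fintype ι] {W : Set (ι → 𝔸)}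
    (hW : IsOpen W) {P : Type*} [Finite P] {f : P → (ι → 𝔸) → ℝ} (hf : ∀ p, AnalyticOnNhd ℝ (f p) W) (r : P → ℝ) :
    ∀ᵐ g ∂(Measure.pi fun _ : ι => μ), (fun i => ρ (g i)) ∈ W →
      ∀ᶠ g' in 𝓝 g, (∀ p, f p (fun i => ρ (g' i)) < r p) ↔ (∀ p, f p (fun i => ρ (g i)) < r p) := by
  haveI : Countable P := Finite.to_countable
  have hall := ae_all_iff.2 fun p => ae_pi_eventually_lt_iff_and_eq_iff μ h hlie hW (hf p) (r p)
  filter_upwards [hall] with g hg hgW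
  filter_upwards [eventually_all.2 fun p => hg p hgW] with g' hg'
  exact forall_congr' fun p => (hg' p).1

end Generic

/-! ## §3 Instances: `SU(N)^ι` and the gauge-field measure `dU = Π_b dU(b)` -/

section Instances

open scoped Matrix.Norms.L2Operator
open Literature.MathematicalPhysics.QuantumLattice (fundamentalRep)

variable {n : Type*} [Fintype n] [DecidableEq n] [Nonempty n]

/-- `SU(N)^ι` (any Haar `μ`, finite `ι`): `(⊗_ι μ)`-a.e. `g` with `(g_i)_i ∈ W` is a continuity point of the sharp
cut-off `𝟙[f(g) < r]`, for `f` real-analytic on the open `W ⊆ M_N(ℂ)^ι`. [cite: BrockerTomDieck1985, IV (2.11) (proof), I (5.12)]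
[cite: Mityagin2015, Proposition 1] -/
theorem pi_specialUnitaryGroup_ae_continuousAt_ite_lt (μ : Measure (Matrix.specialUnitaryGroup n ℂ)) [μ.IsHaarMeasure]
    {ι : Type*} [Fintype ι] {W : Set (ι → Matrix n n ℂ)} (hW : IsOpen W) {f : (ι → Matrix n n ℂ) → ℝ}
    (hf : AnalyticOnNhd ℝ f W) (r : ℝ) :
    ∀ᵐ g : ι → Matrix.specialUnitaryGroup n ℂ ∂(Measure.pi fun _ : ι => μ), (fun i => (g i : Matrix n n ℂ)) ∈ W →
      ContinuousAt (fun g' : ι → Matrix.specialUnitaryGroup n ℂ =>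
        if f (fun i => (g' i : Matrix n n ℂ)) < r then (1 : ℝ) else 0) g :=
  ae_pi_continuousAt_ite_lt μ (isChartRep_specialUnitaryGroup (n := n)) (lie_adStable_specialUnitaryGroup (n := n)) hW hf r

variable {N : ℕ} [NeZero N] (P : Params) (j : ℕ)

/-- The normalised Haar datum of `SU(N)` is a Haar measure. [folklore] -/
private theorem isHaarMeasure_haarData :
    (HaarData.haar : Measure (Matrix.specialUnitaryGroup (Fin N) ℂ)).IsHaarMeasure := by
  show (Measure.haarMeasure ⊤).IsHaarMeasure
  infer_instance

/-- ★★★ **`dU`-A.E. CONFIGURATION IS A POINT OF LOCAL CONSTANCY OF `{f < r}` AND `{f = r}`**: for every torus datum `P`,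
level `j`, `N ≥ 1`, every open `W ⊆ (PBond P j → M_N(ℂ))`, every `f` real-valued real-analytic on `W` and every `r`:
for `dU`-a.e. `SU(N)`-configuration `U` with `U ∈ W`,
`∀ᶠ U' in 𝓝 U, (f U' < r ↔ f U < r) ∧ (f U' = r ↔ f U = r)`. [cite: Balaban1985Averaging, (10) p. 19]
[cite: BrockerTomDieck1985, IV (2.11) (proof), I (5.12)] [cite: Mityagin2015, Proposition 1] -/
theorem fieldMeasure_ae_eventually_lt_iff_and_eq_iff {W : Set (PBond P j → Matrix (Fin N) (Fin N) ℂ)} (hW : IsOpen W)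
    {f : (PBond P j → Matrix (Fin N) (Fin N) ℂ) → ℝ} (hf : AnalyticOnNhd ℝ f W) (r : ℝ) :
    ∀ᵐ U : PBond P j → Matrix.specialUnitaryGroup (Fin N) ℂ ∂(fieldMeasure P j (Matrix.specialUnitaryGroup (Fin N) ℂ)),
      (fun b => (U b : Matrix (Fin N) (Fin N) ℂ)) ∈ W →
        ∀ᶠ U' in 𝓝 U, (f (fun b => ((U' b : Matrix.specialUnitaryGroup (Fin N) ℂ) : Matrix (Fin N) (Fin N) ℂ)) < r ↔
            f (fun b => (U b : Matrix (Fin N) (Fin N) ℂ)) < r) ∧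
          (f (fun b => ((U' b : Matrix.specialUnitaryGroup (Fin N) ℂ) : Matrix (Fin N) (Fin N) ℂ)) = r ↔
            f (fun b => (U b : Matrix (Fin N) (Fin N) ℂ)) = r) := by
  haveI := isHaarMeasure_haarData (N := N)
  exact ae_pi_eventually_lt_iff_and_eq_iff _ (isChartRep_specialUnitaryGroup (n := Fin N))
    (lie_adStable_specialUnitaryGroup (n := Fin N)) hW hf r

/-- ★★ **`dU`-A.E. CONTINUITY OF THE SHARP CUT-OFF `𝟙[f < r]`** for `f` real-analytic on an open set of configurations
(the (2.17)-type small-field functions once their threshold functional is real-analytic on the small-field domain).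
[cite: Balaban1985Averaging, (10) p. 19] [cite: BrockerTomDieck1985, IV (2.11) (proof), I (5.12)] [cite: Mityagin2015, Proposition 1] -/
theorem fieldMeasure_ae_continuousAt_ite_lt {W : Set (PBond P j → Matrix (Fin N) (Fin N) ℂ)} (hW : IsOpen W)
    {f : (PBond P j → Matrix (Fin N) (Fin N) ℂ) → ℝ} (hf : AnalyticOnNhd ℝ f W) (r : ℝ) :
    ∀ᵐ U : PBond P j → Matrix.specialUnitaryGroup (Fin N) ℂ ∂(fieldMeasure P j (Matrix.specialUnitaryGroup (Fin N) ℂ)),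
      (fun b => (U b : Matrix (Fin N) (Fin N) ℂ)) ∈ W →
        ContinuousAt (fun U' : PBond P j → Matrix.specialUnitaryGroup (Fin N) ℂ =>
          if f (fun b => (U' b : Matrix (Fin N) (Fin N) ℂ)) < r then (1 : ℝ) else 0) U := by
  haveI := isHaarMeasure_haarData (N := N)
  exact ae_pi_continuousAt_ite_lt _ (isChartRep_specialUnitaryGroup (n := Fin N))
    (lie_adStable_specialUnitaryGroup (n := Fin N)) hW hf r

/-- ★★ The same for the closed cut-off `𝟙[f ≤ r]`. [cite: Balaban1985Averaging, (10) p. 19]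
[cite: BrockerTomDieck1985, IV (2.11) (proof), I (5.12)] [cite: Mityagin2015, Proposition 1] -/
theorem fieldMeasure_ae_continuousAt_ite_le {W : Set (PBond P j → Matrix (Fin N) (Fin N) ℂ)} (hW : IsOpen W)
    {f : (PBond P j → Matrix (Fin N) (Fin N) ℂ) → ℝ} (hf : AnalyticOnNhd ℝ f W) (r : ℝ) :
    ∀ᵐ U : PBond P j → Matrix.specialUnitaryGroup (Fin N) ℂ ∂(fieldMeasure P j (Matrix.specialUnitaryGroup (Fin N) ℂ)),
      (fun b => (U b : Matrix (Fin N) (Fin N) ℂ)) ∈ W →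
        ContinuousAt (fun U' : PBond P j → Matrix.specialUnitaryGroup (Fin N) ℂ =>
          if f (fun b => (U' b : Matrix (Fin N) (Fin N) ℂ)) ≤ r then (1 : ℝ) else 0) U := by
  haveI := isHaarMeasure_haarData (N := N)
  exact ae_pi_continuousAt_ite_le _ (isChartRep_specialUnitaryGroup (n := Fin N))
    (lie_adStable_specialUnitaryGroup (n := Fin N)) hW hf r


/-- ★★ **`dU`-A.E. LOCAL CONSTANCY OF A FINITE CONJUNCTION OF SMALL-FIELD CONDITIONS** `{∀ p, f_p < r_p}` (finite `P`, every
`f_p` real-analytic on the open `W`) — the (2.17)-shaped consumer face. [cite: Balaban1985Averaging, (10) p. 19]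
[cite: BrockerTomDieck1985, IV (2.11) (proof), I (5.12)] [cite: Mityagin2015, Proposition 1] -/
theorem fieldMeasure_ae_eventually_forall_lt_iff {W : Set (PBond P j → Matrix (Fin N) (Fin N) ℂ)} (hW : IsOpen W)
    {Q : Type*} [Finite Q] {f : Q → (PBond P j → Matrix (Fin N) (Fin N) ℂ) → ℝ} (hf : ∀ q, AnalyticOnNhd ℝ (f q) W)
    (r : Q → ℝ) :
    ∀ᵐ U : PBond P j → Matrix.specialUnitaryGroup (Fin N) ℂ ∂(fieldMeasure P j (Matrix.specialUnitaryGroup (Fin N) ℂ)),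
      (fun b => (U b : Matrix (Fin N) (Fin N) ℂ)) ∈ W →
        ∀ᶠ U' in 𝓝 U, (∀ q, f q (fun b => ((U' b : Matrix.specialUnitaryGroup (Fin N) ℂ) : Matrix (Fin N) (Fin N) ℂ)) < r q) ↔
          (∀ q, f q (fun b => (U b : Matrix (Fin N) (Fin N) ℂ)) < r q) := by
  haveI := isHaarMeasure_haarData (N := N)
  exact ae_pi_eventually_forall_lt_iff _ (isChartRep_specialUnitaryGroup (n := Fin N))
    (lie_adStable_specialUnitaryGroup (n := Fin N)) hW hf r

end Instances

end Literature.MathematicalPhysics.QuantumFieldTheory.Balaban1983to89.HaarAnalyticZeroSetNullLocalCutoff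

end
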